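import Literature.Probability.RandomPlanarGeometry.SAWTriangularDetourSurgery
import Literature.Probability.RandomPlanarGeometry.SAWRatioLimitStepOne
import Literature.Probability.RandomPlanarGeometry.SAWTriangularMonotone
import HarnessLib

/-!
# The ratio-limit engine on the triangular lattice (lane «pcv-sawmu», door (iii-𝕋) «TRI-RATIO», block ENGINE)

Topic `Literature/Probability/RandomPlanarGeometry`. Kesten's ratio limit theorem `c_{N+1}(𝕋)/c_N(𝕋) → μ(𝕋)` with step
ONE (the triangular lattice is not bipartite, so `c_{N+2}/c_N → μ²` of `ℤ^d` — Madras–Slade Theorem 7.3.2 — upgrades to the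
one-step ratio), reduced to its two combinatorial inputs:
* `DetourDensityTri` (block K1′: all but exponentially few `N`-step walks have `> N/(4Q)` sharp turns — the pattern
  theorem for the one-step pattern «tight triangle»), and
* `DetourDensityTri → KestenIneqTri` (block E: Kesten's surgery inequality `φ_N² − D/N ≤ φ_N φ_{N+1}`, `φ_N = c_{N+1}/c_N`,
  from the detour density by the insertion/deletion double counting of blocks P1/P2/C/D).
The remaining hypotheses of the abstract step-one lemma `Zd.tendsto_ratio_of_kesten_one` (block K4, Madras–Slade Lemma
7.3.1 with the index doubled) are discharged BY NAME: (K0) `c_N(𝕋)^{1/N} → μ(𝕋) = exp logMuTri` (`tendsto_triSawCount_rpow`,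
Fekete via the tree's `tendsto_log_triSawCount_div`; typed by a-idea-1 in `Doors_G12` §DoorIIIT), (K3) `c_{N+1}/c_N ≥ 1`
(`one_le_triSawCount_ratio`, `SAWTriangularMonotone`). [cite: MadrasSlade1993, Lemma 7.3.1 (p. 243), Theorem 7.3.2 and
Remark p. 244] Planner faces: a-idea-2 `Custody_TRIRATIO_moduloK1E.lean` (statement of
`tendsto_triSawCount_ratio_of` verbatim). Seat a-p1 gen 5, 2026-08-22.
-/

noncomputable section

open Filter Topology

namespace Literature.Probability.RandomPlanarGeometry.SAW

/-- **(K0) `c_N(𝕋)^{1/N} → μ(𝕋)`** in `rpow` form: `exp` of the Fekete limit `log c_N(𝕋)/N → logMuTri`.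
[cite: MadrasSlade1993, §1.2, (1.2.6)] -/
theorem tendsto_triSawCount_rpow :
    Tendsto (fun n : ℕ => (triSawCount n : ℝ) ^ (1 / (n : ℝ))) atTop (𝓝 (Real.exp logMuTri)) := by
  have h := (Real.continuous_exp.tendsto _).comp tendsto_log_triSawCount_div
  refine h.congr fun n => ?_
  have hpos : (0 : ℝ) < triSawCount n := by exact_mod_cast one_le_triSawCount n
  rw [Function.comp_apply, Real.rpow_def_of_pos hpos, mul_one_div]

/-- **The TRI-RATIO engine** (planner statement `tendsto_triSawCount_ratio_of_K1_E`, verbatim): the detour density (K1′)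
and Kesten's inequality from it (E) give the one-step ratio limit `c_{N+1}(𝕋)/c_N(𝕋) → μ(𝕋)`; K0 and K3 are discharged
by name and K4 is the abstract lemma `Zd.tendsto_ratio_of_kesten_one`.
[cite: MadrasSlade1993, Lemma 7.3.1 (p. 243) and Theorem 7.3.2] -/
theorem tendsto_triSawCount_ratio_of (h4 : DetourDensityTri) (h5 : DetourDensityTri → KestenIneqTri) :
    Tendsto (fun N : ℕ => (triSawCount (N + 1) : ℝ) / triSawCount N) atTop (𝓝 (Real.exp logMuTri)) := by
  obtain ⟨D, hD⟩ := h5 h4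
  exact Zd.tendsto_ratio_of_kesten_one (Real.exp_pos _)
    (fun n => by exact_mod_cast one_le_triSawCount n) tendsto_triSawCount_rpow
    ⟨1, one_pos, Eventually.of_forall one_le_triSawCount_ratio⟩ ⟨D, hD⟩

end Literature.Probability.RandomPlanarGeometry.SAW

end
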